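import Literature.NumberTheory.Automorphic.BianchiBoundaryBorel
import Literature.NumberTheory.Automorphic.BoundaryShapiroHecke
import HarnessLib

/-!
# Reduction of `bianchi_boundaryEigensystem_isReducible` to the cohomology of the Borel stratum

Topic `NumberTheory/Automorphic`; namespace `Literature.NumberTheory.Automorphic`, sub-namespace
`ParallelWeight` (as `BianchiOrdinaryClassicality`).

**Step (A)+(B) of the printed proof** [Harder1987, §1], [KhareThorne2017, §6.5, proof of Thm. 6.23]
assembled for `GL₂/F`: a Hecke eigenclass `ξ ∈ H^q(X_U, Ṽ_wt(E))` which is NOT interior restricts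
to a non-zero eigenclass of the boundary (`BianchiBoundaryEigenclass`), the boundary cohomology is
the cohomology of the single stratum of the cusp `∞` because `GL₂(F)` is transitive on `ℙ¹(F)`
with stabiliser the Borel subgroup `B(F)` (`BianchiBoundaryBorel`), and this identification
(restriction to the orbit, Shapiro) is Hecke-equivariant (`BoundaryShapiroHecke`).  Hence
(`exists_borelEigenclass_of_not_mem_interiorCohomology`): **the eigenvalues `a_{w,1}, a_{w,2}`
(almost all `w`) of a non-interior eigenclass occur on a non-zero class of
`H^q(B(F), Fun(GL₂(𝔸_F^∞)/U, V_wt(E)))`**, the cohomology of the Borel stratum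
(`ParallelWeight.borelCohomology`) with its Hecke operators `T_{w,j} = [U t_{w,j} U]`
(`ParallelWeight.borelHeckeT`).

Consequently the named fact `bianchi_boundaryEigensystem_isReducible` follows from the
corresponding statement for the Borel stratum — Harder's description of the Hecke module
`H^q(B(F), Fun(GL₂(𝔸_F^∞)/U, V_wt))` by pairs of algebraic Hecke characters together with their
`p`-adic Galois avatars — recorded as the reduction
`bianchi_boundaryEigensystem_isReducible_of_borel` (a theorem whose hypothesis is that remaining
statement, spelled out; no new named fact is introduced).

## References

* G. Harder, *Eisenstein cohomology of arithmetic groups. The case GL₂*, Invent. Math. 89 (1987), §1,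
  §2 [Harder1987].
* C. Khare, J. Thorne, Amer. J. Math. 139 (2017), §6.5, proof of Thm. 6.23 [KhareThorne2017].
-/

noncomputable section

open scoped NumberField
open IsDedekindDomain

namespace Literature.NumberTheory.Automorphic

namespace ParallelWeight

variable (E : Type) [Field E] (F : Type) [Field F] (wt : Fin 2 → ℤ) [NumberField F]
  (U : Subgroup (BigHeckeGLn.FiniteAdelicGL 2 F))

/-- **`H^q(B(F), Fun(GL₂(𝔸_F^∞)/U, V_wt(E)))`**, the cohomology of the Borel stratum of the
Borel–Serre boundary of `X_U` (`TwistedQuotient.cohomology` for `Γ = B(F)`, `ι` the diagonal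
embedding restricted to `B(F)`, `V_wt` restricted to `B(F)`). [cite: Harder1987, §1] -/
abbrev borelCohomology (q : ℕ) : ModuleCat E :=
  TwistedQuotient.cohomology (V := CoeffModule E F 2 wt)
    ((BigHeckeGLn.globalEmbedding 2 F).comp (borel F).subtype) U
    ((coeffRep E F 2 wt).comp (borel F).subtype) q

/-- The Hecke operator `T_g = [U g U]`, `g ∈ GL₂(𝔸_F^∞)`, on the cohomology of the Borel stratum.
[cite: Harder1987, §1] -/
abbrev borelHeckeOp (q : ℕ) (g : BigHeckeGLn.FiniteAdelicGL 2 F) :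
    Module.End E (borelCohomology E F wt U q) :=
  TwistedQuotient.heckeEnd (V := CoeffModule E F 2 wt)
    ((BigHeckeGLn.globalEmbedding 2 F).comp (borel F).subtype) U
    ((coeffRep E F 2 wt).comp (borel F).subtype) g q

/-- `T_{w,j} = [U t_{w,j} U]` on the cohomology of the Borel stratum (same elements
`heckeElement 2 F w j` as `ParallelWeight.heckeT`). [cite: Harder1987, §1] -/
abbrev borelHeckeT (q : ℕ) (w : HeightOneSpectrum (𝓞 F)) (j : ℕ) :
    Module.End E (borelCohomology E F wt U q) :=
  borelHeckeOp E F wt U q (BigHeckeGLn.heckeElement 2 F w j)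

/-- **A non-interior eigenclass gives an eigenclass of the Borel stratum** (steps (A) and (B) of
the printed proof): if `ξ ∈ H^q(X_U, Ṽ_wt(E))` is not in `H^q_!` and
`T_{w,1} ξ = a_{w,1} ξ`, `T_{w,2} ξ = a_{w,2} ξ` for almost all `w`, then there is a NON-ZERO
`y ∈ H^q(B(F), Fun(GL₂(𝔸_F^∞)/U, V_wt(E)))` with `T_{w,1} y = a_{w,1} y`, `T_{w,2} y = a_{w,2} y`
for almost all `w`. [cite: Harder1987, §1] [cite: KhareThorne2017, §6.5, proof of Thm. 6.23] -/
theorem exists_borelEigenclass_of_not_mem_interiorCohomology (q : ℕ) {ξ : cohomology E F 2 wt U q}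
    (hξ : ξ ∉ interiorCohomology E F 2 wt U q) (a : HeightOneSpectrum (𝓞 F) → ℕ → E)
    (ha : ∀ᶠ w in Filter.cofinite,
      heckeT E F 2 wt U q w 1 ξ = a w 1 • ξ ∧ heckeT E F 2 wt U q w 2 ξ = a w 2 • ξ) :
    ∃ y : borelCohomology E F wt U q, y ≠ 0 ∧
      ∀ᶠ w in Filter.cofinite,
        borelHeckeT E F wt U q w 1 y = a w 1 • y ∧ borelHeckeT E F wt U q w 2 y = a w 2 • y := by
  -- index the two operators by `Bool`: `false ↦ T_{w,1}`, `true ↦ T_{w,2}`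
  let jdx : Bool → ℕ := fun b => cond b 2 1
  have ha' : ∀ᶠ w in Filter.cofinite, ∀ b : Bool,
      heckeT E F 2 wt U q w (jdx b) ξ = a w (jdx b) • ξ :=
    ha.mono fun w hw b => by cases b <;> simp only [jdx, cond_true, cond_false, hw.1, hw.2]
  obtain ⟨y, hy0, hy⟩ :=
    TwistedQuotient.exists_stratum_eigenclass_of_not_isInterior (V := CoeffModule E F 2 wt)
      (BigHeckeGLn.globalEmbedding 2 F) U (coeffRep E F 2 wt) (ProperSubspace F 2)
      (smul_properSubspace_mono F 2) (lineZero F) (properSubspace_two_eq_of_le F)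
      (exists_smul_lineZero_eq F) q hξ Filter.cofinite
      (fun (b : Bool) (w : HeightOneSpectrum (𝓞 F)) => BigHeckeGLn.heckeElement 2 F w (jdx b))
      (fun w b => a w (jdx b)) ha'
  exact ⟨y, hy0, hy.mono fun w hw => ⟨hw false, hw true⟩⟩

end ParallelWeight

open ParallelWeight BigHeckeGLn in
/-- **Reduction of `bianchi_boundaryEigensystem_isReducible` to the Borel stratum.**  The named
fact follows from the same statement with "non-interior eigenclass of `H^q(X_U, Ṽ_wt)`" replaced
by "non-zero eigenclass of the cohomology `H^q(B(F), Fun(GL₂(𝔸_F^∞)/U, V_wt))` of the Borel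
stratum" (`exists_borelEigenclass_of_not_mem_interiorCohomology`); the latter is Harder's
description of the boundary cohomology of a Bianchi group by pairs of algebraic Hecke characters
with its Galois-theoretic translation, the remaining steps (C), (D) of the printed proof.
[cite: Harder1987, §1–§2] [cite: KhareThorne2017, §6.5, proof of Thm. 6.23] -/
theorem bianchi_boundaryEigensystem_isReducible_of_borel
    (h : ∀ (F : Type) [Field F] [NumberField F], NumberField.IsTotallyComplex F →
      Module.finrank ℚ F = 2 →
      ∀ (p : ℕ) [Fact p.Prime] (wt : Fin 2 → ℤ),
        Literature.NumberTheory.DiophantineGeometry.Weight.IsDominant wt →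
      ∀ (U : Subgroup (FiniteAdelicGL 2 F)), IsOpen (U : Set (FiniteAdelicGL 2 F)) →
        IsCompact (U : Set (FiniteAdelicGL 2 F)) →
      ∀ (q : ℕ) (y : borelCohomology (PadicAlgCl p) F wt U q), y ≠ 0 →
      ∀ (a : HeightOneSpectrum (𝓞 F) → ℕ → PadicAlgCl p),
        (∀ᶠ w in Filter.cofinite, borelHeckeT (PadicAlgCl p) F wt U q w 1 y = a w 1 • y ∧
          borelHeckeT (PadicAlgCl p) F wt U q w 2 y = a w 2 • y) →
        ∃ σ : Literature.NumberTheory.GaloisRepresentations.FramedGaloisRep F (PadicAlgCl p) 2,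
          σ.toGaloisRep.IsSemisimple ∧ ¬ σ.toGaloisRep.IsIrreducible ∧
          ∀ᶠ w in Filter.cofinite, σ.IsUnramifiedAt w ∧
            σ.HasFrobCharpolyAt w (heckeFrobPoly 2 (Ideal.absNorm w.asIdeal) (a w))) :
    bianchi_boundaryEigensystem_isReducible := by
  intro F _ _ hF hF2 p _ wt hwt U hUo hUc q ξ hξ a ha
  obtain ⟨y, hy0, hy⟩ :=
    exists_borelEigenclass_of_not_mem_interiorCohomology (PadicAlgCl p) F wt U q hξ a ha
  exact h F hF hF2 p wt hwt U hUo hUc q y hy0 a hy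

end Literature.NumberTheory.Automorphic
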